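import Mathlib
import HarnessLib
import Summits.ResolutionOfSingularities.ResolutionOfSingularities.Theorems.WildQuotientsWildQuotientResolutionS1aGraphMemberAway
import Summits.ResolutionOfSingularities.ResolutionOfSingularities.Theorems.WildQuotientsWildQuotientResolutionS1aQhSymAwayDatum

/-!
# S1a — R4c cusp, brick (b3-rows): ROWS OF `τ′ = conj Φ σ_chart` ON A PINNED CHART MODEL for the root with TWO MOVING generators

[OURS · L1 W4.5c · lead-1 g17; plan-1 RULING R-F15v (2) ★ R4c `cusp_killsIn_two`, SPEC `Cruxes/CyclicQuotientFourfolds/Lines/s1a_logminvertex-R4c-SPEC.md` §2 (2O):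
pattern ✓`QhAway.qhc_rows_fixed` / ✓`QhAway.qhc_row_one` (GraphMemberAway) for the datum `σ : x₁ ↦ x₁ + x₀, x₂ ↦ x₂ + x₀, x₃ ↦ x₃ + t` (root `(x₀ : w₀, x₁ : w₁, x₂ : w₂)`,
`w₁ + sh ≤ w₀ = w₂ + sh`, ✓QhSymAbsRoot) on a producer chart `ChartRing_y` with a PINNED model `Φ` (`Φ(a) = subst a`, `Φ s = x_none`, `Φ uᵢ′ = x′ᵢ`): `τ′` fixes `x_none`,
`x′₀` and the constants; `τ′x′₁ = x′₁ + x_none^sh·(x′₀·x_none^{w₀−w₁−sh})`, `τ′x′₂ = x′₂ + x_none^sh·x′₀`; the tail row `x₃ ↦ x₃ + x_none^sh·T′`, `σ`-fixed polynomials,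
degrees and the Veronese degree are the generic ✓`QhAway.qhc_row_three` / `qhc_row_subst` / `qhc_degree_u'` / `qhc_degree_tail` / `exists_veroneseNormalised_graphChartAway`
(they do not use the row of `x₂`). For the cusp at `O`: `w = (9,2,3)`, `sh = 6`, `τ′x′₁ = x′₁ + x_none⁷x′₀`, `τ′x′₂ = x′₂ + x_none⁶x′₀`, `τ′x₃ = x₃ + x_none⁶(x′₂² − x′₁³)`]
— NOT statements of the manuscript; counted 0; AI-level work, weaker than expert review. Crux stmt-ResolutionOfSingularities-17941 `CyclicQuotientFourfolds`, line
`s1a-logminvertex` v13 (`stub_reachLowerInFX`).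
-/

set_option linter.dupNamespace false

noncomputable section

open MvPolynomial
open Literature.AlgebraicGeometry.Resolution
open scoped LaurentPolynomial
open Summit.ResolutionOfSingularities.ResolutionOfSingularities.Theorems.WildQuotientResolution.S1
open Summit.ResolutionOfSingularities.ResolutionOfSingularities.Theorems.WildQuotientResolution.S1.CoarseChart
open Summit.ResolutionOfSingularities.ResolutionOfSingularities.Theorems.WildQuotientResolution.S1.ProducerStep
open Summit.ResolutionOfSingularities.ResolutionOfSingularities.Theorems.WildQuotientResolution.S1.ReesBigrading
open Summit.ResolutionOfSingularities.ResolutionOfSingularities.Theorems.WildQuotientResolution.S1.NodeTransport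
open Summit.ResolutionOfSingularities.ResolutionOfSingularities.Theorems.WildQuotientResolution.S1.CobordantTransport
open Summit.ResolutionOfSingularities.ResolutionOfSingularities.Theorems.WildQuotientResolution.S1.NodeAway
open Summit.ResolutionOfSingularities.ResolutionOfSingularities.Theorems.WildQuotientResolution.S1.CentreAway
open Summit.ResolutionOfSingularities.ResolutionOfSingularities.Theorems.WildQuotientResolution.S1.BlowupCharts
open Summit.ResolutionOfSingularities.ResolutionOfSingularities.Theorems.WildQuotientResolution.S1.KillCert
open Summit.ResolutionOfSingularities.ResolutionOfSingularities.Theorems.WildQuotientResolution.S1.GameFrame.GModel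

namespace Summit.ResolutionOfSingularities.ResolutionOfSingularities.Theorems.WildQuotientResolution.S1.KillCert.QhSym

variable {k : Type} [Field k] (σ : (MvPolynomial (Fin 4) k) ≃+* (MvPolynomial (Fin 4) k)) (hC : ∀ a : k, σ (C a) = C a)
  (h0 : σ (X 0) = X 0) (h1 : σ (X 1) = X 1 + X 0) (h2 : σ (X 2) = X 2 + X 0) (t₀ : (MvPolynomial (Fin 4) k)) (h3 : σ (X 3) = X 3 + t₀)
  (w : Fin 3 → ℕ) (sh : ℕ) (hw1 : w 1 + sh ≤ w 0) (hw2 : w 0 = w 2 + sh) (hh : (MvPolynomial (Fin 4) k)) (hσh : σ hh = hh)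
  {p : ℕ} (hp : 0 < p) (hσpL : ∀ y : (Localization.Away hh), (⇑(sigmaAway σ hσh))^[p] y = y)
  (hσJ : ∀ n : ℕ, ((weightedFiltration (fun i => algebraMap (MvPolynomial (Fin 4) k) (Localization.Away hh) (X ((![0, 1, 2] : Fin 3 → Fin 4) i))) w).ideal n).map ((sigmaAway σ hσh) : (Localization.Away hh) →+* (Localization.Away hh)) ≤ (weightedFiltration (fun i => algebraMap (MvPolynomial (Fin 4) k) (Localization.Away hh) (X ((![0, 1, 2] : Fin 3 → Fin 4) i))) w).ideal n)
  {mg : ℕ} (mo : Fin mg → ℕ) (𝒜 : (Π j : Fin mg, ZMod (mo j)) → AddSubgroup (Localization.Away hh)) [GradedRing 𝒜]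
  {dbar : ℕ} (y : ↥(𝒜 0)) (hy : y ∈ (traceFiltration 𝒜 (fun i => algebraMap (MvPolynomial (Fin 4) k) (Localization.Away hh) (X ((![0, 1, 2] : Fin 3 → Fin 4) i))) w).ideal dbar) (hσy : (sigmaAway σ hσh) (y : (Localization.Away hh)) = y)
  {P : Type} [CommRing P] [Algebra (MvPolynomial (Option (Fin 4)) k) P] (Φ : (ChartRing 𝒜 (fun i => algebraMap (MvPolynomial (Fin 4) k) (Localization.Away hh) (X ((![0, 1, 2] : Fin 3 → Fin 4) i))) w dbar y hy) ≃+* P)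
  (hΦa : ∀ a : (MvPolynomial (Fin 4) k), Φ ((algebraMap ↥(cobordantAlgebra (fun i => algebraMap (MvPolynomial (Fin 4) k) (Localization.Away hh) (X ((![0, 1, 2] : Fin 3 → Fin 4) i))) w) (ChartRing 𝒜 (fun i => algebraMap (MvPolynomial (Fin 4) k) (Localization.Away hh) (X ((![0, 1, 2] : Fin 3 → Fin 4) i))) w dbar y hy)) (algebraMap (Localization.Away hh) ↥(cobordantAlgebra (fun i => algebraMap (MvPolynomial (Fin 4) k) (Localization.Away hh) (X ((![0, 1, 2] : Fin 3 → Fin 4) i))) w) (algebraMap (MvPolynomial (Fin 4) k) (Localization.Away hh) a))) = (algebraMap (MvPolynomial (Option (Fin 4)) k) P) (cobordantAlgebra.subst k (![w 0, w 1, w 2, 0] : Fin 4 → ℕ) a))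
  (hΦs : Φ ((algebraMap ↥(cobordantAlgebra (fun i => algebraMap (MvPolynomial (Fin 4) k) (Localization.Away hh) (X ((![0, 1, 2] : Fin 3 → Fin 4) i))) w) (ChartRing 𝒜 (fun i => algebraMap (MvPolynomial (Fin 4) k) (Localization.Away hh) (X ((![0, 1, 2] : Fin 3 → Fin 4) i))) w dbar y hy)) (cobordantAlgebra.s (fun i => algebraMap (MvPolynomial (Fin 4) k) (Localization.Away hh) (X ((![0, 1, 2] : Fin 3 → Fin 4) i))) w)) = (algebraMap (MvPolynomial (Option (Fin 4)) k) P) (X none))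
  (hΦu : ∀ i : Fin 3, Φ ((algebraMap ↥(cobordantAlgebra (fun i => algebraMap (MvPolynomial (Fin 4) k) (Localization.Away hh) (X ((![0, 1, 2] : Fin 3 → Fin 4) i))) w) (ChartRing 𝒜 (fun i => algebraMap (MvPolynomial (Fin 4) k) (Localization.Away hh) (X ((![0, 1, 2] : Fin 3 → Fin 4) i))) w dbar y hy)) (cobordantAlgebra.u' (fun i => algebraMap (MvPolynomial (Fin 4) k) (Localization.Away hh) (X ((![0, 1, 2] : Fin 3 → Fin 4) i))) w i)) = (algebraMap (MvPolynomial (Option (Fin 4)) k) P) (X (some ((![0, 1, 2] : Fin 3 → Fin 4) i))))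

set_option maxHeartbeats 1600000 in
include hC h0 h1 h2 h3 hΦa hΦs hΦu in
/-- Rows: `τ′` FIXES `x_none`, `x′₀` and the constants (the generators `x′₁`, `x′₂` both move). [OURS · L1 W4.5c · R4c] -/
theorem qsc_rows_fixed :
    conj Φ (sigmaChart 𝒜 (fun i => algebraMap (MvPolynomial (Fin 4) k) (Localization.Away hh) (X ((![0, 1, 2] : Fin 3 → Fin 4) i))) w dbar y hy (sigmaAway σ hσh) hσJ hp hσpL hσy) ((algebraMap (MvPolynomial (Option (Fin 4)) k) P) (X none)) = (algebraMap (MvPolynomial (Option (Fin 4)) k) P) (X none) ∧ conj Φ (sigmaChart 𝒜 (fun i => algebraMap (MvPolynomial (Fin 4) k) (Localization.Away hh) (X ((![0, 1, 2] : Fin 3 → Fin 4) i))) w dbar y hy (sigmaAway σ hσh) hσJ hp hσpL hσy) ((algebraMap (MvPolynomial (Option (Fin 4)) k) P) (X (some 0))) = (algebraMap (MvPolynomial (Option (Fin 4)) k) P) (X (some 0)) ∧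
      ∀ a : k, conj Φ (sigmaChart 𝒜 (fun i => algebraMap (MvPolynomial (Fin 4) k) (Localization.Away hh) (X ((![0, 1, 2] : Fin 3 → Fin 4) i))) w dbar y hy (sigmaAway σ hσh) hσJ hp hσpL hσy) ((algebraMap (MvPolynomial (Option (Fin 4)) k) P) (C a)) = (algebraMap (MvPolynomial (Option (Fin 4)) k) P) (C a) := by
  obtain ⟨r0, -, -, -⟩ := qsl_rows σ h0 h1 h2 t₀ h3 hh hσh
  refine ⟨?_, ?_, fun a => ?_⟩
  · rw [← hΦs, conj_apply_map, sigmaChart_algebraMap, sigmaR_s]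
  · have hu := hΦu 0
    change _ = (algebraMap (MvPolynomial (Option (Fin 4)) k) P) (X (some 0)) at hu
    rw [← hu, conj_apply_map, sigmaChart_algebraMap, QhAbs.qha_sigmaR_u'_zero (sigmaAway σ hσh) (fun i => algebraMap (MvPolynomial (Fin 4) k) (Localization.Away hh) (X ((![0, 1, 2] : Fin 3 → Fin 4) i))) w r0 hp hσpL hσJ]
  · have hc : Φ ((algebraMap ↥(cobordantAlgebra (fun i => algebraMap (MvPolynomial (Fin 4) k) (Localization.Away hh) (X ((![0, 1, 2] : Fin 3 → Fin 4) i))) w) (ChartRing 𝒜 (fun i => algebraMap (MvPolynomial (Fin 4) k) (Localization.Away hh) (X ((![0, 1, 2] : Fin 3 → Fin 4) i))) w dbar y hy)) (algebraMap (Localization.Away hh) ↥(cobordantAlgebra (fun i => algebraMap (MvPolynomial (Fin 4) k) (Localization.Away hh) (X ((![0, 1, 2] : Fin 3 → Fin 4) i))) w) (algebraMap (MvPolynomial (Fin 4) k) (Localization.Away hh) (C a)))) = (algebraMap (MvPolynomial (Option (Fin 4)) k) P) (C a) := by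
      rw [hΦa, cobordantAlgebra.subst, MvPolynomial.eval₂Hom_C]
    rw [← hc, conj_apply_map, sigmaChart_algebraMap_algebraMap, sigmaAway_algebraMap, hC]

set_option maxHeartbeats 1600000 in
set_option synthInstance.maxHeartbeats 400000 in
include h0 h1 h2 h3 hw1 hΦs hΦu in
/-- Row of the lighter generator: `τ′ x′₁ = x′₁ + x_none^sh · (x′₀ · x_none^{w₀−(w₁+sh)})`. [OURS · L1 W4.5c · R4c] -/
theorem qsc_row_one :
    conj Φ (sigmaChart 𝒜 (fun i => algebraMap (MvPolynomial (Fin 4) k) (Localization.Away hh) (X ((![0, 1, 2] : Fin 3 → Fin 4) i))) w dbar y hy (sigmaAway σ hσh) hσJ hp hσpL hσy) ((algebraMap (MvPolynomial (Option (Fin 4)) k) P) (X (some 1))) = (algebraMap (MvPolynomial (Option (Fin 4)) k) P) (X (some 1)) + (algebraMap (MvPolynomial (Option (Fin 4)) k) P) (X none) ^ sh * ((algebraMap (MvPolynomial (Option (Fin 4)) k) P) (X (some 0)) * (algebraMap (MvPolynomial (Option (Fin 4)) k) P) (X none) ^ (w 0 - (w 1 + sh))) := by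
  obtain ⟨-, r1, -, -⟩ := qsl_rows σ h0 h1 h2 t₀ h3 hh hσh
  have hu1 := hΦu 1
  change _ = (algebraMap (MvPolynomial (Option (Fin 4)) k) P) (X (some 1)) at hu1
  have hu0 := hΦu 0
  change _ = (algebraMap (MvPolynomial (Option (Fin 4)) k) P) (X (some 0)) at hu0
  rw [← hu1, conj_apply_map, sigmaChart_algebraMap]
  have h := qs_sigmaR_u'_one_sub (sigmaAway σ hσh) (fun i => algebraMap (MvPolynomial (Fin 4) k) (Localization.Away hh) (X ((![0, 1, 2] : Fin 3 → Fin 4) i))) w sh r1 hw1 hp hσpL hσJ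
  rw [sub_eq_iff_eq_add] at h
  rw [h, map_add (algebraMap ↥(cobordantAlgebra (fun i => algebraMap (MvPolynomial (Fin 4) k) (Localization.Away hh) (X ((![0, 1, 2] : Fin 3 → Fin 4) i))) w) (ChartRing 𝒜 (fun i => algebraMap (MvPolynomial (Fin 4) k) (Localization.Away hh) (X ((![0, 1, 2] : Fin 3 → Fin 4) i))) w dbar y hy)), map_add Φ, map_mul (algebraMap ↥(cobordantAlgebra (fun i => algebraMap (MvPolynomial (Fin 4) k) (Localization.Away hh) (X ((![0, 1, 2] : Fin 3 → Fin 4) i))) w) (ChartRing 𝒜 (fun i => algebraMap (MvPolynomial (Fin 4) k) (Localization.Away hh) (X ((![0, 1, 2] : Fin 3 → Fin 4) i))) w dbar y hy)), map_mul Φ, map_pow (algebraMap ↥(cobordantAlgebra (fun i => algebraMap (MvPolynomial (Fin 4) k) (Localization.Away hh) (X ((![0, 1, 2] : Fin 3 → Fin 4) i))) w) (ChartRing 𝒜 (fun i => algebraMap (MvPolynomial (Fin 4) k) (Localization.Away hh) (X ((![0, 1, 2] : Fin 3 → Fin 4) i))) w dbar y hy)), map_pow Φ, map_mul (algebraMap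 ↥(cobordantAlgebra (fun i => algebraMap (MvPolynomial (Fin 4) k) (Localization.Away hh) (X ((![0, 1, 2] : Fin 3 → Fin 4) i))) w) (ChartRing 𝒜 (fun i => algebraMap (MvPolynomial (Fin 4) k) (Localization.Away hh) (X ((![0, 1, 2] : Fin 3 → Fin 4) i))) w dbar y hy)), map_mul Φ, map_pow (algebraMap ↥(cobordantAlgebra (fun i => algebraMap (MvPolynomial (Fin 4) k) (Localization.Away hh) (X ((![0, 1, 2] : Fin 3 → Fin 4) i))) w) (ChartRing 𝒜 (fun i => algebraMap (MvPolynomial (Fin 4) k) (Localization.Away hh) (X ((![0, 1, 2] : Fin 3 → Fin 4) i))) w dbar y hy)), map_pow Φ, hu1, hu0, hΦs, add_comm]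

set_option maxHeartbeats 1600000 in
set_option synthInstance.maxHeartbeats 400000 in
include h0 h1 h2 h3 hw2 hΦs hΦu in
/-- Row of the heavier generator: `τ′ x′₂ = x′₂ + x_none^sh · x′₀`. [OURS · L1 W4.5c · R4c] -/
theorem qsc_row_two :
    conj Φ (sigmaChart 𝒜 (fun i => algebraMap (MvPolynomial (Fin 4) k) (Localization.Away hh) (X ((![0, 1, 2] : Fin 3 → Fin 4) i))) w dbar y hy (sigmaAway σ hσh) hσJ hp hσpL hσy) ((algebraMap (MvPolynomial (Option (Fin 4)) k) P) (X (some 2))) = (algebraMap (MvPolynomial (Option (Fin 4)) k) P) (X (some 2)) + (algebraMap (MvPolynomial (Option (Fin 4)) k) P) (X none) ^ sh * (algebraMap (MvPolynomial (Option (Fin 4)) k) P) (X (some 0)) := by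
  obtain ⟨-, -, r2, -⟩ := qsl_rows σ h0 h1 h2 t₀ h3 hh hσh
  have hu2 := hΦu 2
  change _ = (algebraMap (MvPolynomial (Option (Fin 4)) k) P) (X (some 2)) at hu2
  have hu0 := hΦu 0
  change _ = (algebraMap (MvPolynomial (Option (Fin 4)) k) P) (X (some 0)) at hu0
  rw [← hu2, conj_apply_map, sigmaChart_algebraMap]
  have h := qs_sigmaR_u'_two_sub (sigmaAway σ hσh) (fun i => algebraMap (MvPolynomial (Fin 4) k) (Localization.Away hh) (X ((![0, 1, 2] : Fin 3 → Fin 4) i))) w sh r2 hw2 hp hσpL hσJ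
  rw [sub_eq_iff_eq_add] at h
  rw [h, map_add (algebraMap ↥(cobordantAlgebra (fun i => algebraMap (MvPolynomial (Fin 4) k) (Localization.Away hh) (X ((![0, 1, 2] : Fin 3 → Fin 4) i))) w) (ChartRing 𝒜 (fun i => algebraMap (MvPolynomial (Fin 4) k) (Localization.Away hh) (X ((![0, 1, 2] : Fin 3 → Fin 4) i))) w dbar y hy)), map_add Φ, map_mul (algebraMap ↥(cobordantAlgebra (fun i => algebraMap (MvPolynomial (Fin 4) k) (Localization.Away hh) (X ((![0, 1, 2] : Fin 3 → Fin 4) i))) w) (ChartRing 𝒜 (fun i => algebraMap (MvPolynomial (Fin 4) k) (Localization.Away hh) (X ((![0, 1, 2] : Fin 3 → Fin 4) i))) w dbar y hy)), map_mul Φ, map_pow (algebraMap ↥(cobordantAlgebra (fun i => algebraMap (MvPolynomial (Fin 4) k) (Localization.Away hh) (X ((![0, 1, 2] : Fin 3 → Fin 4) i))) w) (ChartRing 𝒜 (fun i => algebraMap (MvPolynomial (Fin 4) k) (Localization.Away hh) (X ((![0, 1, 2] : Fin 3 → Fin 4) i))) w dbar y hy)), map_pow Φ, hu2, hu0, hΦs,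 add_comm]

/-- **The cusp tail in the free model at `O`**: `subst (x₂² − x₁³) = x_none⁶ · (x′₂² − x′₁³)` for the weights `(9, 2, 3, 0)`. [OURS · L1 W4.5c · R4c] -/
theorem subst_cuspTail :
    cobordantAlgebra.subst k (![9, 2, 3, 0] : Fin 4 → ℕ) (X 2 ^ 2 - X 1 ^ 3 : (MvPolynomial (Fin 4) k)) = X none ^ 6 * (X (some 2) ^ 2 - X (some 1) ^ 3 : (MvPolynomial (Option (Fin 4)) k)) := by
  have hX : ∀ i : Fin 4, cobordantAlgebra.subst k (![9, 2, 3, 0] : Fin 4 → ℕ) (X i) = X none ^ (![9, 2, 3, 0] : Fin 4 → ℕ) i * X (some i) := fun i => by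
    rw [cobordantAlgebra.subst, MvPolynomial.eval₂Hom_X']
  rw [map_sub, map_pow, map_pow, hX, hX]
  simp only [Matrix.cons_val_one, Matrix.cons_val]
  ring

/-- **The cusp tail in the free model at `Q`**: `subst T_Q = x_none² · T′` for the weights `(3, 1, 2, 0)`,
`T′ = x_none²V′² + 2x_noneV′Y′ + 2c·V′ + (1 − 3a)Y′² − x_noneY′³` (`Y′ = x′₁`, `V′ = x′₂`). [OURS · L1 W4.5c · R4c] -/
theorem subst_cuspTailQ (a c : k) :
    cobordantAlgebra.subst k (![3, 1, 2, 0] : Fin 4 → ℕ) (X 2 ^ 2 + 2 * X 1 * X 2 + C (2 * c) * X 2 + C (1 - 3 * a) * X 1 ^ 2 - X 1 ^ 3 : (MvPolynomial (Fin 4) k)) =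
      X none ^ 2 * (X none ^ 2 * X (some 2) ^ 2 + 2 * X none * X (some 2) * X (some 1) + C (2 * c) * X (some 2) + C (1 - 3 * a) * X (some 1) ^ 2 -
        X none * X (some 1) ^ 3 : (MvPolynomial (Option (Fin 4)) k)) := by
  have hX : ∀ i : Fin 4, cobordantAlgebra.subst k (![3, 1, 2, 0] : Fin 4 → ℕ) (X i) = X none ^ (![3, 1, 2, 0] : Fin 4 → ℕ) i * X (some i) := fun i => by
    rw [cobordantAlgebra.subst, MvPolynomial.eval₂Hom_X']
  have hC' : ∀ b : k, cobordantAlgebra.subst k (![3, 1, 2, 0] : Fin 4 → ℕ) (C b) = C b := fun b => by rw [cobordantAlgebra.subst, MvPolynomial.eval₂Hom_C]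
  simp only [map_sub, map_add, map_mul, map_pow, map_ofNat, hX, hC', Matrix.cons_val_one, Matrix.cons_val]
  ring

end Summit.ResolutionOfSingularities.ResolutionOfSingularities.Theorems.WildQuotientResolution.S1.KillCert.QhSym

end
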